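import Summits.Ventures.PercRepro.Night2FatBudgetCells

/-!
# PercRepro — `(3, 0)` at `|G| = 13` closes outright; the residues L (night-2, gen 23)

* `exists_twoFat_of_one_lt_card_fatClosures` — two fat thin closures give two fat thin members missing different sets;
* **`localShadowHall_three_zero_six_thirteen`** — the cell `(3, 0)` at `|G| = 13` for every `G` with a fat thin member:
  at most one fat thin closure through the fatBudget (`Night2FatBudgetCells`), two through the two-hyperplane count of
  gen 22 (`localShadowHall_three_zero_six_thirteen_of_twoFat`);
* **`shadowHall_seven_five_of_residuesL`** — the `(7, 5)` shadow row modulo the residues K with the `(3, 0)` range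
  shrunk to `10 ≤ |G| ≤ 12` and the clauses «at least `5 / 3 / 2` fat thin closures» at `|G| = 10 / 11 / 12`.
-/

namespace PercRepro.Shadow

open Finset PerFlat ThmH

variable {α : Type*} [DecidableEq α] {M : Matroid α} [M.Finite]

open scoped Classical in
/-- Two fat thin closures give two fat thin members missing DIFFERENT sets. -/
theorem exists_twoFat_of_one_lt_card_fatClosures {q : ℕ} {G : Finset α}
    (h : 1 < (fatClosures M q G 2).card) :
    ∃ B₀ ∈ thinMembers M q G, ∃ B₁ ∈ thinMembers M q G,
      (G \ clF M B₀).card ≤ 2 ∧ (G \ clF M B₁).card ≤ 2 ∧ G \ clF M B₀ ≠ G \ clF M B₁ := by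
  rw [Finset.one_lt_card] at h
  obtain ⟨H₀, hH₀, H₁, hH₁, hne⟩ := h
  unfold fatClosures at hH₀ hH₁
  rw [Finset.mem_image] at hH₀ hH₁
  obtain ⟨B₀, hB₀, rfl⟩ := hH₀
  obtain ⟨B₁, hB₁, rfl⟩ := hH₁
  rw [Finset.mem_filter] at hB₀ hB₁
  refine ⟨B₀, hB₀.1, B₁, hB₁.1, hB₀.2, hB₁.2, ?_⟩
  intro heq
  apply hne
  have h0 : clF M B₀ ⊆ G := (mem_membersIn.1 (mem_thinMembers.1 hB₀.1).1).2
  have h1 : clF M B₁ ⊆ G := (mem_membersIn.1 (mem_thinMembers.1 hB₁.1).1).2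
  rw [← Finset.sdiff_sdiff_eq_self h0, heq, Finset.sdiff_sdiff_eq_self h1]

open scoped Classical in
/-- **THE CELL `(3, 0)` AT `|G| = 13` CLOSES OUTRIGHT** (given a fat thin member): with at most one fat thin closure
through the budget, with two through the two-hyperplane count of gen 22. -/
theorem localShadowHall_three_zero_six_thirteen {G : Finset α} (hG : G ∈ flatsQ M (5 + 1))
    (hd : (gr M \ G).card = 3) (hk : kColoops M G = 0)
    (hs : ∀ e ∈ gr M, ∀ f ∈ gr M, e ≠ f → rkN M {e, f} = 2) (hl : ∀ e ∈ gr M, M.Indep {e})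
    (hn : G.card = 13) {B₀ : Finset α} (hB₀ : B₀ ∈ thinMembers M 5 G) (hfat : (G \ clF M B₀).card ≤ 2) :
    LocalShadowHall M 5 G := by
  by_cases hcl : (fatClosures M 5 G 2).card ≤ 1
  · exact localShadowHall_three_zero_six_thirteen_of_oneFatClosure hG hd hk hs hl hn hB₀ hfat hcl
  · push Not at hcl
    obtain ⟨B₀', hB₀', B₁, hB₁, hf₀, hf₁, hne⟩ := exists_twoFat_of_one_lt_card_fatClosures hcl
    exact localShadowHall_three_zero_six_thirteen_of_twoFat hG hd hk hs hl hn hB₀' hB₁ hf₀ hf₁ hne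

section SevenFiveL

variable {α' : Type} [DecidableEq α']

/-- **THE `(7, 5)` SHADOW ROW FOR EVERY FINITE MATROID MODULO THE RESIDUES L**: the residues of
`shadowHall_seven_five_of_residuesK` with the `(3, 0)` range shrunk to `10 ≤ |G| ≤ 12` (the cell `|G| = 13` is closed
outright) and the extra clauses «at least `5 / 3 / 2` fat thin closures» at `|G| = 10 / 11 / 12`. -/
theorem shadowHall_seven_five_of_residuesL
    (h20 : ∀ (N : Matroid α') [N.Finite] (G : Finset α'), CellHyp N G →
      (gr N \ G).card = 2 → kColoops N G = 0 → FatMember N G 6 3 →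
      (FatBasis N G 6 2 ∨ FatMember N G 6 2) → LocalShadowHall N 5 G)
    (h21 : ∀ (N : Matroid α') [N.Finite] (G : Finset α'), CellHyp N G →
      (gr N \ G).card = 2 → kColoops N G = 1 → FatMember N G 5 4 →
      (FatBasis N G 5 3 ∨ FatMember N G 5 3) → LocalShadowHall N 5 G)
    (h30 : ∀ (N : Matroid α') [N.Finite] (G : Finset α'), CellHyp N G →
      (gr N \ G).card = 3 → kColoops N G = 0 → 10 ≤ G.card → G.card ≤ 12 → FatMember N G 6 2 →
      FatBasis N G 6 2 → (G.card = 10 ∨ G.card = 12 → NoThreeDisjointFat N G 2) →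
      (G.card = 11 → NoFourDisjointFat N G 2) →
      (G.card = 10 → 5 ≤ (fatClosures N 5 G 2).card) → (G.card = 11 → 3 ≤ (fatClosures N 5 G 2).card) →
      (G.card = 12 → 2 ≤ (fatClosures N 5 G 2).card) → LocalShadowHall N 5 G)
    (h31 : ∀ (N : Matroid α') [N.Finite] (G : Finset α'), CellHyp N G →
      (gr N \ G).card = 3 → kColoops N G = 1 → 11 ≤ G.card → G.card ≤ 17 → FatMember N G 5 2 →
      (G.card = 17 → FatBasis N G 5 2) → (G.card = 17 → NestedFat N G 2 3) →
      (G.card = 16 → MeetingFat N G 2) → (11 ≤ G.card ∧ G.card ≤ 17 → NoThreeDisjointFat N G 2) →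
      (G.card = 11 ∨ G.card = 15 ∨ G.card = 16 → FatBasis N G 5 3) →
      (12 ≤ G.card ∧ G.card ≤ 14 → FatBasis N G 5 4) → LocalShadowHall N 5 G)
    (h32 : ∀ (N : Matroid α') [N.Finite] (G : Finset α'), CellHyp N G →
      (gr N \ G).card = 3 → kColoops N G = 2 → FatMember N G 4 2 → LocalShadowHall N 5 G)
    (M : Matroid α') [M.Finite] : ShadowHall M 7 5 (phiK 7 5) := by
  apply shadowHall_seven_five_of_residuesK h20 h21 _ h31 h32
  intro N _ G hcell hd hk h10 h13 hfm hfb hnest hnd3 hnd4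
  have hfm' := hfm
  obtain ⟨B₀, hB₀, -, hfat⟩ := hfm'
  by_cases hG13 : G.card = 13
  · exact localShadowHall_three_zero_six_thirteen hcell.2.2.2 hd hk hcell.1 hcell.2.1 hG13 hB₀ hfat
  have h12 : G.card ≤ 12 := by omega
  have hnd3' : G.card = 10 ∨ G.card = 12 → NoThreeDisjointFat N G 2 := by
    intro h
    apply hnd3
    rcases h with h | h
    · exact Or.inl h
    · exact Or.inr (Or.inl h)
  by_cases hG10 : G.card = 10
  · by_cases hfive : 5 ≤ (fatClosures N 5 G 2).card
    · exact h30 N G hcell hd hk h10 h12 hfm hfb hnd3' hnd4 (fun _ => hfive) (fun h => absurd h (by omega))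
        (fun h => absurd h (by omega))
    · push Not at hfive
      by_cases hone : (fatClosures N 5 G 2).card ≤ 1
      · exact localShadowHall_three_zero_six_ten_of_oneFatClosure hcell.2.2.2 hd hk hcell.1 hcell.2.1 hG10 hB₀
          hfat hone
      · push Not at hone
        obtain ⟨B₀', hB₀', B₁, hB₁, hf₀, hf₁, hne⟩ := exists_twoFat_of_one_lt_card_fatClosures hone
        exact localShadowHall_three_zero_six_ten_of_twoFat_b4 hcell.2.2.2 hd hk hcell.1 hcell.2.1 hG10 hB₀' hB₁
          hf₀ hf₁ hne (by omega)
  by_cases hG11 : G.card = 11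
  · by_cases hthree : 3 ≤ (fatClosures N 5 G 2).card
    · exact h30 N G hcell hd hk h10 h12 hfm hfb hnd3' hnd4 (fun h => absurd h hG10) (fun _ => hthree)
        (fun h => absurd h (by omega))
    · push Not at hthree
      by_cases hone : (fatClosures N 5 G 2).card ≤ 1
      · exact localShadowHall_three_zero_six_eleven_of_oneFatClosure hcell.2.2.2 hd hk hcell.1 hcell.2.1 hG11 hB₀
          hfat hone
      · push Not at hone
        obtain ⟨B₀', hB₀', B₁, hB₁, hf₀, hf₁, hne⟩ := exists_twoFat_of_one_lt_card_fatClosures hone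
        exact localShadowHall_three_zero_six_eleven_of_twoFat_b2 hcell.2.2.2 hd hk hcell.1 hcell.2.1 hG11 hB₀' hB₁
          hf₀ hf₁ hne (by omega)
  have hG12 : G.card = 12 := by omega
  by_cases htwo : 2 ≤ (fatClosures N 5 G 2).card
  · exact h30 N G hcell hd hk h10 h12 hfm hfb hnd3' hnd4 (fun h => absurd h hG10) (fun h => absurd h hG11)
      (fun _ => htwo)
  · push Not at htwo
    exact localShadowHall_three_zero_six_twelve_of_oneFatClosure hcell.2.2.2 hd hk hcell.1 hcell.2.1 hG12 hB₀ hfat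
      (by omega)

end SevenFiveL

end PercRepro.Shadow
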